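import Literature.Geometry.Symplectic.OrigamiCutBlowDown
import Literature.Topology.FourManifolds.ImmersionCriterion
import HarnessLib

/-!
# The centre of a cut piece: corank of the blow-down along the fold, embedding, symplecticity

Proofs companion of `OrigamiUnfolding.lean` (the named fact
`Literature.Geometry.Symplectic.exists_symplecticCutPieces_of_isOrigamiForm`, Cannas da
Silva–Guillemin–Pires, *Symplectic Origami*, IMRN 2011 = arXiv:0909.4065, Prop. 2.8, Def. 2.13,
proof of Prop. 2.26), step (S4) concluded, for `D : CutCollarData M N`:

* `mfderiv_cutSlice_zero_apply_eq_zero_iff` — on the zero section the differential of the real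
  slice `(n, t) ↦ [n, t]` kills exactly `ℝ (X_n, 0)` (`ker dπ = ℝ X`, `OrigamiCutRealSlice.lean`
  for `t ≠ 0`);
* `finrank_ker_mfderiv_blowDown_c_zero` — **along the fold the blow-down has corank one**: at
  `c (n, 0)` the kernel of `d(blowDown) = d(inB) ∘ d(cutSlice) ∘ d(c⁻¹)` is the line spanned by
  `dc (X_n, 0)` (the fibre direction of `Z → B`);
* `isSmoothEmbedding_centre` — the centre `N/S¹ → M₀` is a `C^∞` embedding (compact source,
  injective immersion: `injective_mfderiv_cutZero`);
* `pieceForm_centre_nondegenerate` — **the centre is a symplectic submanifold**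
  (`cutFormQ_cutZero_nondegenerate`: on the zero section the reduced form is `ωZ`, whose kernel
  on `N` is `ℝ X = ker dπ`).

Everything here is proved; no definitions, no facts.

## References

* A. Cannas da Silva, V. Guillemin, A. R. Pires, *Symplectic Origami*, IMRN 2011 =
  arXiv:0909.4065, Prop. 2.8, Def. 2.13, proof of Prop. 2.26. [CannasdasilvaGuilleminPires2010]
-/

noncomputable section

open scoped Manifold ContDiff Topology
open Set Function Filter TopologicalSpace
open _root_.Topology
open Literature.Geometry.Kaehler Literature.Geometry.Manifold

namespace Literature.Geometry.Symplectic

universe u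

/-! ### The kernel of the slice differential on the zero section -/

section Slice

variable {k : ℕ} {N : Type*} [TopologicalSpace N] [ChartedSpace (EuclideanSpace ℝ (Fin k)) N]
  [IsManifold (𝓡 k) ∞ N] [T2Space N] [MulAction Circle N]
  (hθ : ContMDiff ((𝓡 1).prod (𝓡 k)) (𝓡 k) ∞ (fun x : Circle × N => x.1 • x.2))
  (hfree : ∀ (a : Circle) (x : N), a • x = x → a = 1)

/-- The differential of the real slice in terms of `dπ` and the tangent lift:
`d(cutSlice)_{(n, t)} (a, σ) = dπ_{(n, t)} (L (a, σ))`. [folklore] -/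
theorem mfderiv_cutSlice_apply (n : N) (t : ℝ) (a : EuclideanSpace ℝ (Fin k)) (σ : ℝ) :
    letI := cutChartedSpace hθ hfree
    mfderiv ((𝓡 k).prod 𝓘(ℝ, ℝ)) (𝓡 (k + 1)) (cutSlice : N × ℝ → CutSpace k N) (n, t)
        ((a, σ) : EuclideanSpace ℝ (Fin k) × ℝ) =
      mfderiv (𝓡 (k + 2)) (𝓡 (k + 1)) (circleQuotientMk : ProdC k N → CutSpace k N)
        (realSlice k N (n, t)) (ProdC.tangentLift k a (σ : ℂ)) := by
  letI := cutChartedSpace hθ hfree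
  haveI := isManifold_cutSpace hθ hfree
  have hπ : MDifferentiableAt (𝓡 (k + 2)) (𝓡 (k + 1))
      (circleQuotientMk : ProdC k N → CutSpace k N) (realSlice k N (n, t)) :=
    ((contMDiff_circleQuotientMk_prodC hθ hfree) _).mdifferentiableAt (by simp)
  have hR : MDifferentiableAt ((𝓡 k).prod 𝓘(ℝ, ℝ)) (𝓡 (k + 2)) (realSlice k N) (n, t) :=
    (contMDiff_realSlice (k := k) (N := N) (n, t)).mdifferentiableAt (by simp)
  have hcomp : mfderiv ((𝓡 k).prod 𝓘(ℝ, ℝ)) (𝓡 (k + 1)) (cutSlice : N × ℝ → CutSpace k N) (n, t) =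
      (mfderiv (𝓡 (k + 2)) (𝓡 (k + 1)) (circleQuotientMk : ProdC k N → CutSpace k N)
        (realSlice k N (n, t))).comp
        (mfderiv ((𝓡 k).prod 𝓘(ℝ, ℝ)) (𝓡 (k + 2)) (realSlice k N) (n, t)) := by
    rw [cutSlice_eq_comp]; exact mfderiv_comp _ hπ hR
  rw [hcomp]
  exact congrArg (mfderiv (𝓡 (k + 2)) (𝓡 (k + 1)) (circleQuotientMk : ProdC k N → CutSpace k N)
    (realSlice k N (n, t))) (mfderiv_realSlice_apply (k := k) (N := N) (n, t) a σ)

/-- **On the zero section, `d(cutSlice)_{(n, 0)} (a, σ) = 0` iff `σ = 0` and `a ∈ ℝ X_n`.**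
[cite: CannasdasilvaGuilleminPires2010, Prop. 2.8] -/
theorem mfderiv_cutSlice_zero_apply_eq_zero_iff (n : N) (a : EuclideanSpace ℝ (Fin k)) (σ : ℝ) :
    letI := cutChartedSpace hθ hfree
    mfderiv ((𝓡 k).prod 𝓘(ℝ, ℝ)) (𝓡 (k + 1)) (cutSlice : N × ℝ → CutSpace k N) (n, 0)
        ((a, σ) : EuclideanSpace ℝ (Fin k) × ℝ) = 0 ↔
      σ = 0 ∧ ∃ c : ℝ, a = c • circleFundVec n := by
  letI := cutChartedSpace hθ hfree
  haveI := isManifold_cutSpace hθ hfree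
  have hF : Module.finrank ℝ (EuclideanSpace ℝ (Fin (k + 1))) + 1 = k + 2 := by
    rw [finrank_euclideanSpace_fin]
  -- the fundamental vector of the diagonal action at `(n, 0)`
  have hX : circleFundVec (realSlice k N (n, 0)) = ProdC.tangentLift k (circleFundVec n) 0 := by
    rw [circleFundVec_eq, show realSlice k N (n, 0) = ProdC.mk n ((0 : ℝ) : ℂ) from rfl,
      ProdC.mfderiv_circleOrbit_prodC hθ, Complex.ofReal_zero, mul_zero]
    rfl
  rw [mfderiv_cutSlice_apply hθ hfree]
  constructor
  · intro h0
    obtain ⟨c, hc⟩ := exists_smul_of_mfderiv_circleQuotientMk_eq_zero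
      (ProdC.contMDiff_smul_prodC hθ) (ProdC.smul_eq_self_prodC hfree) hF (realSlice k N (n, 0)) _ h0
    rw [hX] at hc
    -- read the components through the model isomorphism
    have hc' : ((a, (σ : ℂ)) : EuclideanSpace ℝ (Fin k) × ℂ) =
        c • ((circleFundVec n, (0 : ℂ)) : EuclideanSpace ℝ (Fin k) × ℂ) := by
      apply (prodCModelIso k).injective
      rw [map_smul]
      exact hc
    rw [Prod.smul_mk, smul_zero, Prod.mk.injEq] at hc'
    exact ⟨Complex.ofReal_eq_zero.1 hc'.2, c, hc'.1⟩
  · rintro ⟨hσ, c, ha⟩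
    subst hσ
    have h1 : ProdC.tangentLift k a ((0 : ℝ) : ℂ) =
        (c • circleFundVec (realSlice k N (n, 0)) : TangentSpace (𝓡 (k + 2)) (realSlice k N (n, 0))) := by
      rw [hX, ha, Complex.ofReal_zero]
      exact (congrArg (ProdC.tangentLift k (c • circleFundVec n)) (smul_zero c).symm).trans
        (ProdC.tangentLift_smul c _ _)
    rw [h1, map_smul, circleFundVec_eq,
      mfderiv_circleQuotientMk_apply_orbit (ProdC.contMDiff_smul_prodC hθ)
        (ProdC.smul_eq_self_prodC hfree) hF]
    exact smul_zero (A := EuclideanSpace ℝ (Fin (k + 1))) c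

end Slice

namespace CutCollarData

variable {M : Type u} [TopologicalSpace M] [ChartedSpace (EuclideanSpace ℝ (Fin 4)) M]
  [IsManifold (𝓡 4) ∞ M]
  {N : Type} [TopologicalSpace N] [ChartedSpace (EuclideanSpace ℝ (Fin 3)) N]
  [IsManifold (𝓡 3) ∞ N] [T2Space N] [Nonempty N] [MulAction Circle N] (D : CutCollarData M N)

/-! ### The differential of the blow-down at a fold point -/

/-- `bandB` has at `c (n, 0)` the differential `d(cutSlice)_{(n,0)} ∘ d(c⁻¹)`. [folklore] -/
theorem hasMFDerivAt_bandB_c_zero (n : N) :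
    letI := D.csB
    HasMFDerivAt (𝓡 4) (𝓡 (3 + 1)) D.bandB (D.c (n, 0))
      ((mfderiv ((𝓡 3).prod 𝓘(ℝ, ℝ)) (𝓡 (3 + 1)) (cutSlice : N × ℝ → CutSpace 3 N) (n, 0)).comp
        (mfderiv (𝓡 4) ((𝓡 3).prod 𝓘(ℝ, ℝ)) D.cInv (D.c (n, 0)))) := by
  letI := D.csB
  haveI := isManifold_cutSpace D.smooth_act D.free_act
  have hx : D.c (n, 0) ∈ D.c '' D.band := ⟨(n, 0), D.zero_mem_band n, rfl⟩
  have hC : HasMFDerivAt (𝓡 4) ((𝓡 3).prod 𝓘(ℝ, ℝ)) D.cInv (D.c (n, 0))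
      (mfderiv (𝓡 4) ((𝓡 3).prod 𝓘(ℝ, ℝ)) D.cInv (D.c (n, 0))) :=
    ((D.contMDiffOn_cInv.contMDiffAt (D.isOpen_image_band.mem_nhds hx)).mdifferentiableAt
      (by simp)).hasMFDerivAt
  have hP : HasMFDerivAt (𝓡 4) ((𝓡 3).prod 𝓘(ℝ, ℝ)) D.bandParam (D.c (n, 0))
      (mfderiv (𝓡 4) ((𝓡 3).prod 𝓘(ℝ, ℝ)) D.cInv (D.c (n, 0))) := by
    refine hC.congr_of_eventuallyEq ?_
    filter_upwards [D.isOpen_image_band.mem_nhds hx] with x hx'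
    exact D.bandParam_of_mem hx'
  have hS0 : HasMFDerivAt ((𝓡 3).prod 𝓘(ℝ, ℝ)) (𝓡 (3 + 1)) (cutSlice : N × ℝ → CutSpace 3 N) (n, 0)
      (mfderiv ((𝓡 3).prod 𝓘(ℝ, ℝ)) (𝓡 (3 + 1)) (cutSlice : N × ℝ → CutSpace 3 N) (n, 0)) :=
    ((contMDiff_cutSlice D.smooth_act D.free_act (n, 0)).mdifferentiableAt (by simp)).hasMFDerivAt
  have hS : HasMFDerivAt ((𝓡 3).prod 𝓘(ℝ, ℝ)) (𝓡 (3 + 1)) (cutSlice : N × ℝ → CutSpace 3 N)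
      (D.bandParam (D.c (n, 0)))
      (mfderiv ((𝓡 3).prod 𝓘(ℝ, ℝ)) (𝓡 (3 + 1)) (cutSlice : N × ℝ → CutSpace 3 N) (n, 0)) := by
    rw [D.bandParam_c (D.zero_mem_band n)]; exact hS0
  exact hasMFDerivAt_codRestrict_of_comp_eq (g := D.bandB) rfl (hS.comp _ hP)

/-- **The differential of the blow-down at a fold point**:
`d(blowDown)_{c(n,0)} = d(inB) ∘ d(cutSlice)_{(n,0)} ∘ d(c⁻¹)`. [folklore] -/
theorem mfderiv_blowDown_c_zero (n : N) :
    letI := D.csB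
    mfderiv (𝓡 4) (𝓡 4) D.blowDown (D.c (n, 0)) =
      (mfderiv (𝓡 (3 + 1)) (𝓡 4) D.inB (D.bandB (D.c (n, 0)))).comp
        ((mfderiv ((𝓡 3).prod 𝓘(ℝ, ℝ)) (𝓡 (3 + 1)) (cutSlice : N × ℝ → CutSpace 3 N) (n, 0)).comp
          (mfderiv (𝓡 4) ((𝓡 3).prod 𝓘(ℝ, ℝ)) D.cInv (D.c (n, 0)))) := by
  letI := D.csB
  haveI := isManifold_cutSpace D.smooth_act D.free_act
  have hx : D.c (n, 0) ∈ D.c '' D.band := ⟨(n, 0), D.zero_mem_band n, rfl⟩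
  have hev : D.blowDown =ᶠ[𝓝 (D.c (n, 0))] (D.inB ∘ D.bandB) := by
    filter_upwards [D.isOpen_image_band.mem_nhds hx] with y hy
    exact D.blowDown_of_mem_band hy
  have hI : HasMFDerivAt (𝓡 (3 + 1)) (𝓡 4) D.inB (D.bandB (D.c (n, 0)))
      (mfderiv (𝓡 (3 + 1)) (𝓡 4) D.inB (D.bandB (D.c (n, 0)))) :=
    ((D.contMDiff_inB _).mdifferentiableAt (by simp)).hasMFDerivAt
  rw [hev.mfderiv_eq]
  exact (hI.comp _ (D.hasMFDerivAt_bandB_c_zero n)).mfderiv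

/-- The differential of the blow-down at a fold point, applied to a vector. [folklore] -/
theorem mfderiv_blowDown_c_zero_apply (n : N) (v : TangentSpace (𝓡 4) (D.c (n, 0))) :
    letI := D.csB
    mfderiv (𝓡 4) (𝓡 4) D.blowDown (D.c (n, 0)) v =
      mfderiv (𝓡 (3 + 1)) (𝓡 4) D.inB (D.bandB (D.c (n, 0)))
        (mfderiv ((𝓡 3).prod 𝓘(ℝ, ℝ)) (𝓡 (3 + 1)) (cutSlice : N × ℝ → CutSpace 3 N) (n, 0)
          (mfderiv (𝓡 4) ((𝓡 3).prod 𝓘(ℝ, ℝ)) D.cInv (D.c (n, 0)) v)) := by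
  rw [D.mfderiv_blowDown_c_zero n]
  rfl

/-- `d(inB)` is injective. [folklore] -/
theorem injective_mfderiv_inB (b : D.B) :
    letI := D.csB; Injective (mfderiv (𝓡 (3 + 1)) (𝓡 4) D.inB b) := by
  letI := D.csB
  haveI := isManifold_cutSpace D.smooth_act D.free_act
  have hid := mfderiv_invFun_comp_mfderiv D.inB_injective D.contMDiff_inB D.contMDiffAt_invFun_inB b
  intro u u' h
  have h1 : mfderiv (𝓡 4) (𝓡 (3 + 1)) (Function.invFun D.inB) (D.inB b)
      (mfderiv (𝓡 (3 + 1)) (𝓡 4) D.inB b u) = u := congrArg (fun L => L u) hid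
  have h2 : mfderiv (𝓡 4) (𝓡 (3 + 1)) (Function.invFun D.inB) (D.inB b)
      (mfderiv (𝓡 (3 + 1)) (𝓡 4) D.inB b u') = u' := congrArg (fun L => L u') hid
  rw [← h1, ← h2, h]

/-- The fibre direction at a fold point: `dc_{(n,0)} (X_n, 0)`. [folklore] -/
def fibreVec (n : N) : TangentSpace (𝓡 4) (D.c (n, 0)) :=
  mfderiv ((𝓡 3).prod 𝓘(ℝ, ℝ)) (𝓡 4) D.c (n, 0) ((circleFundVec n, 0) : EuclideanSpace ℝ (Fin 3) × ℝ)

omit [IsManifold (𝓡 4) ∞ M] [T2Space N] [Nonempty N] in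
/-- The fibre direction is non-zero. [folklore] -/
theorem fibreVec_ne_zero (n : N) : D.fibreVec n ≠ 0 := by
  intro h
  have hX : circleFundVec (m := 3) n ≠ 0 :=
    mfderiv_circleOrbit_apply_one_ne_zero (θ := fun (a : Circle) (x : N) => a • x) D.smooth_act
      (one_smul Circle) (fun a b x => mul_smul a b x) D.free_act n
  have hinj := (D.bij_c n 0 ⟨by linarith [D.δ_pos], D.δ_pos⟩).1
  have h0 : ((circleFundVec n, 0) : EuclideanSpace ℝ (Fin 3) × ℝ) = 0 :=
    hinj (h.trans (map_zero _).symm)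
  exact hX (Prod.mk_eq_zero.1 h0).1

/-- **The kernel of the blow-down differential at a fold point is the fibre line.**
[cite: CannasdasilvaGuilleminPires2010, Def. 2.13] -/
theorem mfderiv_blowDown_c_zero_apply_eq_zero_iff (n : N) (v : TangentSpace (𝓡 4) (D.c (n, 0))) :
    mfderiv (𝓡 4) (𝓡 4) D.blowDown (D.c (n, 0)) v = 0 ↔ ∃ r : ℝ, v = r • D.fibreVec n := by
  letI := D.csB
  haveI := isManifold_cutSpace D.smooth_act D.free_act
  have hband : ∀ x ∈ D.band, Bijective (mfderiv ((𝓡 3).prod 𝓘(ℝ, ℝ)) (𝓡 4) D.c x) :=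
    fun x hx => D.bij_c x.1 x.2 hx.2
  have h0 := D.zero_mem_band n
  -- `C ∘ dc = id` and `dc ∘ C = id` at `(n, 0)`
  have hCc : ∀ u : TangentSpace ((𝓡 3).prod 𝓘(ℝ, ℝ)) ((n, (0 : ℝ)) : N × ℝ),
      mfderiv (𝓡 4) ((𝓡 3).prod 𝓘(ℝ, ℝ)) D.cInv (D.c (n, 0))
        (mfderiv ((𝓡 3).prod 𝓘(ℝ, ℝ)) (𝓡 4) D.c (n, 0) u) = u :=
    fun u => mfderiv_invFunOn_comp_mfderiv D.isOpen_band D.smooth_c D.injOn_c hband h0 u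
  have hcC : ∀ w : TangentSpace (𝓡 4) (D.c (n, 0)),
      mfderiv ((𝓡 3).prod 𝓘(ℝ, ℝ)) (𝓡 4) D.c (n, 0)
        (mfderiv (𝓡 4) ((𝓡 3).prod 𝓘(ℝ, ℝ)) D.cInv (D.c (n, 0)) w) = w :=
    fun w => mfderiv_comp_mfderiv_invFunOn D.isOpen_band D.smooth_c D.injOn_c hband h0 w
  rw [D.mfderiv_blowDown_c_zero_apply n]
  constructor
  · intro hv
    have hS : mfderiv ((𝓡 3).prod 𝓘(ℝ, ℝ)) (𝓡 (3 + 1)) (cutSlice : N × ℝ → CutSpace 3 N) (n, 0)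
        (mfderiv (𝓡 4) ((𝓡 3).prod 𝓘(ℝ, ℝ)) D.cInv (D.c (n, 0)) v) = 0 :=
      D.injective_mfderiv_inB _ (hv.trans (map_zero _).symm)
    set w : EuclideanSpace ℝ (Fin 3) × ℝ := mfderiv (𝓡 4) ((𝓡 3).prod 𝓘(ℝ, ℝ)) D.cInv (D.c (n, 0)) v
      with hw
    have hw' : mfderiv ((𝓡 3).prod 𝓘(ℝ, ℝ)) (𝓡 (3 + 1)) (cutSlice : N × ℝ → CutSpace 3 N) (n, 0)
        ((w.1, w.2) : EuclideanSpace ℝ (Fin 3) × ℝ) = 0 := hS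
    obtain ⟨h2, r, h1⟩ :=
      (mfderiv_cutSlice_zero_apply_eq_zero_iff D.smooth_act D.free_act n w.1 w.2).1 hw'
    refine ⟨r, ?_⟩
    have hwr : w = r • ((circleFundVec n, 0) : EuclideanSpace ℝ (Fin 3) × ℝ) :=
      Prod.ext h1 (show w.2 = r • (0 : ℝ) by rw [h2, smul_zero])
    calc v = mfderiv ((𝓡 3).prod 𝓘(ℝ, ℝ)) (𝓡 4) D.c (n, 0) w := (hcC v).symm
      _ = mfderiv ((𝓡 3).prod 𝓘(ℝ, ℝ)) (𝓡 4) D.c (n, 0)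
            (r • ((circleFundVec n, 0) : EuclideanSpace ℝ (Fin 3) × ℝ)) := by rw [hwr]
      _ = r • D.fibreVec n := (mfderiv ((𝓡 3).prod 𝓘(ℝ, ℝ)) (𝓡 4) D.c (n, 0)).map_smul r _
  · rintro ⟨r, rfl⟩
    have h1 : mfderiv (𝓡 4) ((𝓡 3).prod 𝓘(ℝ, ℝ)) D.cInv (D.c (n, 0)) (r • D.fibreVec n) =
        r • ((circleFundVec n, 0) : EuclideanSpace ℝ (Fin 3) × ℝ) := by
      rw [map_smul]
      exact congrArg (fun w => r • w) (hCc _)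
    have h2 : mfderiv ((𝓡 3).prod 𝓘(ℝ, ℝ)) (𝓡 (3 + 1)) (cutSlice : N × ℝ → CutSpace 3 N) (n, 0)
        (mfderiv (𝓡 4) ((𝓡 3).prod 𝓘(ℝ, ℝ)) D.cInv (D.c (n, 0)) (r • D.fibreVec n)) = 0 := by
      rw [h1]
      exact (mfderiv_cutSlice_zero_apply_eq_zero_iff D.smooth_act D.free_act n
        (r • circleFundVec n) (r • (0 : ℝ))).2 ⟨smul_zero r, r, rfl⟩
    rw [h2]
    exact map_zero _

/-- **Along the fold the blow-down has corank one**: `dim ker d(blowDown)_{c(n,0)} = 1`.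
[cite: CannasdasilvaGuilleminPires2010, Def. 2.13] -/
theorem finrank_ker_mfderiv_blowDown_c_zero (n : N) :
    Module.finrank ℝ (LinearMap.ker (mfderiv (𝓡 4) (𝓡 4) D.blowDown (D.c (n, 0))).toLinearMap) = 1 := by
  have hker : LinearMap.ker (mfderiv (𝓡 4) (𝓡 4) D.blowDown (D.c (n, 0))).toLinearMap =
      Submodule.span ℝ {D.fibreVec n} := by
    ext v
    rw [LinearMap.mem_ker, ContinuousLinearMap.coe_coe, D.mfderiv_blowDown_c_zero_apply_eq_zero_iff,
      Submodule.mem_span_singleton]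
    constructor
    · rintro ⟨r, rfl⟩; exact ⟨r, rfl⟩
    · rintro ⟨r, rfl⟩; exact ⟨r, rfl⟩
  rw [hker]
  exact finrank_span_singleton (D.fibreVec_ne_zero n)

/-- The corank clause of the fact: on the fold image `c (N × {0})` the kernel of `d(blowDown)` is a
line. [cite: CannasdasilvaGuilleminPires2010, Def. 2.13] -/
theorem finrank_ker_mfderiv_blowDown_of_mem {x : M} (hx : x ∈ D.c '' (univ ×ˢ {0})) :
    Module.finrank ℝ (LinearMap.ker (mfderiv (𝓡 4) (𝓡 4) D.blowDown x).toLinearMap) = 1 := by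
  obtain ⟨⟨n, t⟩, ⟨-, ht⟩, rfl⟩ := hx
  rw [mem_singleton_iff] at ht
  subst ht
  exact D.finrank_ker_mfderiv_blowDown_c_zero n

/-! ### The centre is an embedded symplectic surface -/

/-- `finrank ℝ ℝ² + 1 = 3`. [folklore] -/
theorem finrank_two_add_one : Module.finrank ℝ (EuclideanSpace ℝ (Fin 2)) + 1 = 3 := by
  rw [finrank_euclideanSpace_fin]

/-- The charted-space structure of `N/S¹` (slice charts, model `ℝ²`). [folklore] -/
@[reducible] def csQ : ChartedSpace (EuclideanSpace ℝ (Fin 2)) (CircleQuotient N) :=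
  circleQuotientChartedSpace (EuclideanSpace ℝ (Fin 2)) D.smooth_act D.free_act finrank_two_add_one

omit [IsManifold (𝓡 4) ∞ M] [Nonempty N] in
/-- `N/S¹` is a `C^∞` surface. [cite: LeeSmoothManifolds2013, Thm. 21.10] -/
theorem isManifold_Q : letI := D.csQ; IsManifold (𝓡 2) ∞ (CircleQuotient N) := by
  letI := D.csQ
  exact isManifold_circleQuotient (F := EuclideanSpace ℝ (Fin 2)) D.smooth_act D.free_act finrank_two_add_one

omit [IsManifold (𝓡 4) ∞ M] [Nonempty N] in
/-- The zero section `zeroB` is `C^∞`. [folklore] -/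
theorem contMDiff_zeroB : letI := D.csB; letI := D.csQ; ContMDiff (𝓡 2) (𝓡 (3 + 1)) ∞ D.zeroB := by
  letI := D.csB
  letI := D.csQ
  haveI := isManifold_cutSpace D.smooth_act D.free_act
  exact (ContMDiff.subtypeVal_comp_iff D.B D.zeroB).1
    (contMDiff_cutZero D.smooth_act D.free_act finrank_two_add_one)

omit [IsManifold (𝓡 4) ∞ M] [Nonempty N] in
/-- The differential of `zeroB` is that of `cutZero`. [folklore] -/
theorem mfderiv_zeroB (y : CircleQuotient N) :
    letI := D.csB; letI := D.csQ
    mfderiv (𝓡 2) (𝓡 (3 + 1)) D.zeroB y =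
      mfderiv (𝓡 2) (𝓡 (3 + 1)) (cutZero : CircleQuotient N → CutSpace 3 N) y := by
  letI := D.csB
  letI := D.csQ
  haveI := isManifold_cutSpace D.smooth_act D.free_act
  haveI := D.isManifold_Q
  have h0 : HasMFDerivAt (𝓡 2) (𝓡 (3 + 1)) (cutZero : CircleQuotient N → CutSpace 3 N) y
      (mfderiv (𝓡 2) (𝓡 (3 + 1)) (cutZero : CircleQuotient N → CutSpace 3 N) y) :=
    ((contMDiff_cutZero D.smooth_act D.free_act finrank_two_add_one y).mdifferentiableAt
      (by simp)).hasMFDerivAt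
  exact (hasMFDerivAt_codRestrict_of_comp_eq (g := D.zeroB) rfl h0).mfderiv

omit [IsManifold (𝓡 4) ∞ M] [Nonempty N] in
/-- **The zero section `N/S¹ → cutDisc δ` is a `C^∞` embedding** (compact source, injective
immersion). [cite: CannasdasilvaGuilleminPires2010, Prop. 2.8] -/
theorem isSmoothEmbedding_zeroB [CompactSpace N] :
    letI := D.csB; letI := D.csQ
    Manifold.IsSmoothEmbedding (𝓡 2) (𝓡 (3 + 1)) ∞ D.zeroB := by
  letI := D.csB
  letI := D.csQ
  haveI := isManifold_cutSpace D.smooth_act D.free_act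
  haveI := D.isManifold_Q
  haveI : T2Space (CutSpace 3 N) := by
    haveI := ProdC.continuousSMul_prodC D.smooth_act
    infer_instance
  refine Literature.Topology.FourManifolds.isSmoothEmbedding_of_injective_of_injective_mfderiv
    D.contMDiff_zeroB (by simp) D.zeroB_injective fun y => ?_
  obtain ⟨n, rfl⟩ := circleQuotientMk_surjective y
  rw [D.mfderiv_zeroB]
  exact injective_mfderiv_cutZero D.smooth_act D.free_act finrank_two_add_one n

/-- **The centre `N/S¹ → M₀` is a `C^∞` embedding.** [cite: CannasdasilvaGuilleminPires2010, Prop. 2.8] -/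
theorem isSmoothEmbedding_centre [CompactSpace N] :
    letI := D.csQ
    Manifold.IsSmoothEmbedding (𝓡 2) (𝓡 4) ∞ D.centre := by
  letI := D.csQ
  exact D.isSmoothEmbedding_inB_comp D.isSmoothEmbedding_zeroB

/-- The centre is `C^∞`. [folklore] -/
theorem contMDiff_centre : letI := D.csQ; ContMDiff (𝓡 2) (𝓡 4) ∞ D.centre := by
  letI := D.csB
  letI := D.csQ
  haveI := isManifold_cutSpace D.smooth_act D.free_act
  exact D.contMDiff_inB.comp D.contMDiff_zeroB

/-- The differential of the centre: `d(centre) = d(inB) ∘ d(cutZero)`. [folklore] -/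
theorem mfderiv_centre_apply (y : CircleQuotient N) (u : EuclideanSpace ℝ (Fin 2)) :
    letI := D.csB; letI := D.csQ
    mfderiv (𝓡 2) (𝓡 4) D.centre y u =
      mfderiv (𝓡 (3 + 1)) (𝓡 4) D.inB (D.zeroB y)
        (mfderiv (𝓡 2) (𝓡 (3 + 1)) (cutZero : CircleQuotient N → CutSpace 3 N) y u) := by
  letI := D.csB
  letI := D.csQ
  haveI := isManifold_cutSpace D.smooth_act D.free_act
  haveI := D.isManifold_Q
  have hI : MDifferentiableAt (𝓡 (3 + 1)) (𝓡 4) D.inB (D.zeroB y) :=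
    (D.contMDiff_inB _).mdifferentiableAt (by simp)
  have hZ : MDifferentiableAt (𝓡 2) (𝓡 (3 + 1)) D.zeroB y :=
    (D.contMDiff_zeroB y).mdifferentiableAt (by simp)
  rw [show D.centre = D.inB ∘ D.zeroB from rfl, mfderiv_comp y hI hZ]
  exact congrArg (mfderiv (𝓡 (3 + 1)) (𝓡 4) D.inB (D.zeroB y))
    (congrArg (fun L => L u) (D.mfderiv_zeroB y))

/-- **The centre is a symplectic submanifold of the cut piece**: for `u ≠ 0` tangent to `N/S¹`
there is `u'` with `ω₀ (centre y) (d centre u, d centre u') ≠ 0`.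
[cite: CannasdasilvaGuilleminPires2010, Prop. 2.8] -/
theorem pieceForm_centre_nondegenerate (y : CircleQuotient N) (u : EuclideanSpace ℝ (Fin 2)) (hu : u ≠ 0) :
    letI := D.csQ
    ∃ u' : EuclideanSpace ℝ (Fin 2),
      D.pieceForm (D.centre y) ![mfderiv (𝓡 2) (𝓡 4) D.centre y u, mfderiv (𝓡 2) (𝓡 4) D.centre y u'] ≠ 0 := by
  letI := D.csB
  letI := D.csQ
  haveI := isManifold_cutSpace D.smooth_act D.free_act
  haveI := D.isManifold_Q
  obtain ⟨u', hu'⟩ := cutFormQ_cutZero_nondegenerate D.smooth_act D.free_act D.basic_ωZ D.smooth_α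
    D.inv_α D.α_X D.basic_dα finrank_two_add_one D.ker_ωZ y u hu
  refine ⟨u', ?_⟩
  rw [D.mfderiv_centre_apply, D.mfderiv_centre_apply]
  have hvec : (![mfderiv (𝓡 (3 + 1)) (𝓡 4) D.inB (D.zeroB y)
        (mfderiv (𝓡 2) (𝓡 (3 + 1)) (cutZero : CircleQuotient N → CutSpace 3 N) y u),
      mfderiv (𝓡 (3 + 1)) (𝓡 4) D.inB (D.zeroB y)
        (mfderiv (𝓡 2) (𝓡 (3 + 1)) (cutZero : CircleQuotient N → CutSpace 3 N) y u')] :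
        Fin 2 → TangentSpace (𝓡 4) (D.inB (D.zeroB y))) =
      fun i => mfderiv (𝓡 (3 + 1)) (𝓡 4) D.inB (D.zeroB y)
        (![mfderiv (𝓡 2) (𝓡 (3 + 1)) (cutZero : CircleQuotient N → CutSpace 3 N) y u,
          mfderiv (𝓡 2) (𝓡 (3 + 1)) (cutZero : CircleQuotient N → CutSpace 3 N) y u'] i) := by
    funext i; fin_cases i <;> rfl
  rw [centre_apply, hvec, D.pieceForm_inB_apply]
  exact hu'

end CutCollarData

end Literature.Geometry.Symplectic

end
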